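import Summits.Ventures.LatticeQCDFlow.Scoring.SU2HandleIdentity
import Summits.Ventures.LatticeQCDFlow.Scoring.ProductHaarSlices
import HarnessLib

/-!
# SU(2): merging faces and closing handles under product Haar measure — the character integral of one row of the torus

HONEST FRAMING: exact (Metropolis-corrected) sampling algorithms for lattice gauge theory;
figures of merit are autocorrelation/cost numbers at stated couplings and volumes; no
continuum-physics claim.

Venture `LatticeQCDFlow` (cell pub-lqcd), sub-topic `Scoring`; FANOUT row 5 (`s0-sun-a`), GEN-10.
NEW WORK of the cell (placement rule); step 6b of row 5's route to the exact SU(2) torus formula.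
With `χ_n = U_n(a₀)` (Chebyshev `U` of the half-trace) the characters of `SU(2)` and `Haar^{⊗ι}` the
product Haar probability on `SU(2)^ι`:

* `integral_pi_su2_merge` — **face merging inside a product**: if `α, β, γ, P` do not depend on the
  coordinate `c`, then `∫ χ_n(α·w_c·β)·χ_m(γ·w_c⁻¹)·P dHaar^{⊗ι}(w) = [n = m]·(n+1)⁻¹·∫ χ_n(α·γ·β)·P dHaar^{⊗ι}`
  (`SU2ClassFunctionConvolution.integral_su2Character_mul_conv` on the slice `w_c`);
* `integral_pi_su2_handle` — **closing a handle inside a product**: likewise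
  `∫ χ_n(α·w_c·β·w_c⁻¹)·P dHaar^{⊗ι} = (n+1)⁻¹·∫ χ_n(α)·χ_n(β)·P dHaar^{⊗ι}`
  (`SU2HandleIdentity.integral_su2Character_handle` on the slice);
* **`integral_row_su2Character`** — THE ROW INTEGRAL: for `L ≥ 1`, `a, b : ℤ/L → SU(2)` (bottom and
  top horizontal links of a row of the torus `(ℤ/L)²`), `m : ℤ/L → ℕ` and the vertical links
  `w : ℤ/L → SU(2)` of the row,
  `∫ ∏_i χ_{m_i}(a_i·w_{i+1}·b_i⁻¹·w_i⁻¹) dHaar^{⊗(ℤ/L)}(w)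
     = [m ≡ m_0]·χ_{m_0}(a_0 a_1 ⋯ a_{L−1})·χ_{m_0}(b_0 b_1 ⋯ b_{L−1}) / (m_0+1)^L`
  — `L − 1` face mergings along the row (`integral_row_su2Character_step`, by induction on the number
  of merged faces) followed by one handle integration: the row of plaquettes becomes the pair of
  characters of the two row holonomies (Polyakov lines), with the representation constant along the row.

Elementary given the convolution and handle identities; nothing is cited; no `def`.
-/

noncomputable section

open Real MeasureTheory Set Function Finset Polynomial.Chebyshev
open Literature.MathematicalPhysics.QuantumFieldTheory Literature.MathematicalPhysics.QuantumLattice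
open Summit.Ventures.LatticeQCDFlow.Exactness

namespace Summit.Ventures.LatticeQCDFlow.Scoring

/-! ## §1. Bookkeeping on `SU(2)` -/

/-- `SU(2)` is second countable (a subspace of `ℂ^{2×2}`). -/
theorem secondCountableTopology_su2 : SecondCountableTopology (Matrix.specialUnitaryGroup (Fin 2) ℂ) :=
  haveI : SecondCountableTopology (Matrix (Fin 2) (Fin 2) ℂ) :=
    inferInstanceAs (SecondCountableTopology (Fin 2 → Fin 2 → ℂ))
  TopologicalSpace.Subtype.secondCountableTopology _

/-- `a₀` is cyclic: `a₀(A·B) = a₀(B·A)`. -/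
theorem su2a0_mul_comm (A B : Matrix.specialUnitaryGroup (Fin 2) ℂ) : su2a0 (A * B) = su2a0 (B * A) := by
  rw [← su2a0_conj A⁻¹ (A * B)]
  congr 1
  group

/-- The character `w ↦ χ_n(φ(w))` of a continuous `SU(2)`-valued map is continuous. -/
theorem continuous_su2Character_comp {Ω : Type*} [TopologicalSpace Ω] (n : ℕ)
    {φ : Ω → Matrix.specialUnitaryGroup (Fin 2) ℂ} (hφ : Continuous φ) :
    Continuous fun w => (U ℝ n).eval (su2a0 (φ w)) :=
  (U ℝ n).continuous.comp (continuous_su2a0.comp hφ)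

/-! ## §2. Face merging and handle closing inside a product Haar integral -/

section Product

variable {ι : Type*} [Fintype ι] [DecidableEq ι]

omit [DecidableEq ι] in
/-- Continuous real functions on `SU(2)^ι` are integrable for product Haar measure. -/
theorem integrable_pi_su2_of_continuous {f : (ι → Matrix.specialUnitaryGroup (Fin 2) ℂ) → ℝ}
    (hf : Continuous f) :
    Integrable f (Measure.pi fun _ : ι => haarProbability (Matrix.specialUnitaryGroup (Fin 2) ℂ)) := by
  haveI := secondCountableTopology_su2
  exact integrable_of_continuous_compactSpace hf

/-- **Face merging inside a product Haar integral.**  If `α, β, γ : SU(2)^ι → SU(2)` and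
`P : SU(2)^ι → ℝ` are continuous and do not depend on the coordinate `c`, then
`∫ χ_n(α·w_c·β)·χ_m(γ·w_c⁻¹)·P dHaar^{⊗ι}(w) = [n = m]·(n+1)⁻¹·∫ χ_n(α·γ·β)·P dHaar^{⊗ι}(w)`. -/
theorem integral_pi_su2_merge (c : ι)
    (α β γ : (ι → Matrix.specialUnitaryGroup (Fin 2) ℂ) → Matrix.specialUnitaryGroup (Fin 2) ℂ)
    (P : (ι → Matrix.specialUnitaryGroup (Fin 2) ℂ) → ℝ)
    (hα : ∀ w g, α (update w c g) = α w) (hβ : ∀ w g, β (update w c g) = β w)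
    (hγ : ∀ w g, γ (update w c g) = γ w) (hP : ∀ w g, P (update w c g) = P w)
    (hαc : Continuous α) (hβc : Continuous β) (hγc : Continuous γ) (hPc : Continuous P) (n m : ℕ) :
    ∫ w, (U ℝ n).eval (su2a0 (α w * w c * β w)) * (U ℝ m).eval (su2a0 (γ w * (w c)⁻¹)) * P w
        ∂(Measure.pi fun _ : ι => haarProbability (Matrix.specialUnitaryGroup (Fin 2) ℂ)) =
      if n = m then (n + 1 : ℝ)⁻¹ *
        ∫ w, (U ℝ n).eval (su2a0 (α w * γ w * β w)) * P w
          ∂(Measure.pi fun _ : ι => haarProbability (Matrix.specialUnitaryGroup (Fin 2) ℂ))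
      else 0 := by
  have hint : Integrable (fun w : ι → Matrix.specialUnitaryGroup (Fin 2) ℂ =>
      (U ℝ n).eval (su2a0 (α w * w c * β w)) * (U ℝ m).eval (su2a0 (γ w * (w c)⁻¹)) * P w)
      (Measure.pi fun _ : ι => haarProbability (Matrix.specialUnitaryGroup (Fin 2) ℂ)) := by
    refine integrable_pi_su2_of_continuous ((Continuous.mul ?_ ?_).mul hPc)
    · exact continuous_su2Character_comp n ((hαc.mul (continuous_apply c)).mul hβc)
    · exact continuous_su2Character_comp m (hγc.mul (continuous_apply c).inv)
  rw [integral_pi_eq_integral_update _ c hint]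
  -- the slice integral at fixed `w`
  have hslice : ∀ w : ι → Matrix.specialUnitaryGroup (Fin 2) ℂ,
      (∫ g, (U ℝ n).eval (su2a0 (α (update w c g) * update w c g c * β (update w c g))) *
          (U ℝ m).eval (su2a0 (γ (update w c g) * (update w c g c)⁻¹)) * P (update w c g)
          ∂(haarProbability (Matrix.specialUnitaryGroup (Fin 2) ℂ))) =
        if n = m then (n + 1 : ℝ)⁻¹ * ((U ℝ n).eval (su2a0 (α w * γ w * β w)) * P w) else 0 := by
    intro w
    simp_rw [update_self, hα, hβ, hγ, hP]
    rw [integral_mul_const]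
    have hpt : ∀ g : Matrix.specialUnitaryGroup (Fin 2) ℂ,
        (U ℝ n).eval (su2a0 (α w * g * β w)) * (U ℝ m).eval (su2a0 (γ w * g⁻¹)) =
          (U ℝ n).eval (su2a0 (β w * α w * g)) * (U ℝ m).eval (su2a0 (g⁻¹ * γ w)) := by
      intro g
      rw [show α w * g * β w = (α w * g) * β w from rfl, su2a0_mul_comm (α w * g) (β w),
        ← mul_assoc, su2a0_mul_comm (γ w) g⁻¹]
    simp_rw [hpt]
    rw [integral_su2Character_mul_conv (β w * α w) (γ w) n m]
    by_cases hnm : n = m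
    · subst hnm
      rw [if_pos rfl, if_pos rfl, show β w * α w * γ w = β w * (α w * γ w) from mul_assoc _ _ _,
        su2a0_mul_comm (β w) (α w * γ w)]
      ring
    · rw [if_neg hnm, if_neg hnm, zero_mul]
  simp_rw [hslice]
  by_cases hnm : n = m
  · simp_rw [if_pos hnm]
    rw [integral_const_mul]
  · simp_rw [if_neg hnm]
    rw [integral_zero]

/-- **Closing a handle inside a product Haar integral.**  If `α, β : SU(2)^ι → SU(2)` and
`P : SU(2)^ι → ℝ` are continuous and do not depend on the coordinate `c`, then
`∫ χ_n(α·w_c·β·w_c⁻¹)·P dHaar^{⊗ι}(w) = (n+1)⁻¹·∫ χ_n(α)·χ_n(β)·P dHaar^{⊗ι}(w)`. -/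
theorem integral_pi_su2_handle (c : ι)
    (α β : (ι → Matrix.specialUnitaryGroup (Fin 2) ℂ) → Matrix.specialUnitaryGroup (Fin 2) ℂ)
    (P : (ι → Matrix.specialUnitaryGroup (Fin 2) ℂ) → ℝ)
    (hα : ∀ w g, α (update w c g) = α w) (hβ : ∀ w g, β (update w c g) = β w)
    (hP : ∀ w g, P (update w c g) = P w)
    (hαc : Continuous α) (hβc : Continuous β) (hPc : Continuous P) (n : ℕ) :
    ∫ w, (U ℝ n).eval (su2a0 (α w * w c * β w * (w c)⁻¹)) * P w
        ∂(Measure.pi fun _ : ι => haarProbability (Matrix.specialUnitaryGroup (Fin 2) ℂ)) =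
      (n + 1 : ℝ)⁻¹ *
        ∫ w, (U ℝ n).eval (su2a0 (α w)) * (U ℝ n).eval (su2a0 (β w)) * P w
          ∂(Measure.pi fun _ : ι => haarProbability (Matrix.specialUnitaryGroup (Fin 2) ℂ)) := by
  have hint : Integrable (fun w : ι → Matrix.specialUnitaryGroup (Fin 2) ℂ =>
      (U ℝ n).eval (su2a0 (α w * w c * β w * (w c)⁻¹)) * P w)
      (Measure.pi fun _ : ι => haarProbability (Matrix.specialUnitaryGroup (Fin 2) ℂ)) := by
    refine integrable_pi_su2_of_continuous (Continuous.mul ?_ hPc)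
    exact continuous_su2Character_comp n
      (((hαc.mul (continuous_apply c)).mul hβc).mul (continuous_apply c).inv)
  rw [integral_pi_eq_integral_update _ c hint]
  have hslice : ∀ w : ι → Matrix.specialUnitaryGroup (Fin 2) ℂ,
      (∫ g, (U ℝ n).eval (su2a0 (α (update w c g) * update w c g c * β (update w c g) *
          (update w c g c)⁻¹)) * P (update w c g)
          ∂(haarProbability (Matrix.specialUnitaryGroup (Fin 2) ℂ))) =
        (n + 1 : ℝ)⁻¹ * ((U ℝ n).eval (su2a0 (α w)) * (U ℝ n).eval (su2a0 (β w)) * P w) := by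
    intro w
    simp_rw [update_self, hα, hβ, hP]
    rw [integral_mul_const, integral_su2Character_handle (α w) (β w) n]
    ring
  simp_rw [hslice]
  rw [integral_const_mul]

end Product

/-! ## §3. The row integral: `L − 1` face mergings and one handle -/

section Row

variable {L : ℕ}

/-- Residues `j ≠ k` below `L` have distinct casts in `ℤ/L`. -/
theorem natCast_zmod_ne_of_lt {j k : ℕ} (hj : j < L) (hk : k < L) (h : j ≠ k) :
    ((j : ℕ) : ZMod L) ≠ ((k : ℕ) : ZMod L) := by
  intro e
  apply h
  have := congrArg ZMod.val e
  rwa [ZMod.val_natCast, ZMod.val_natCast, Nat.mod_eq_of_lt hj, Nat.mod_eq_of_lt hk] at this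

/-- If `k + 1 < val i` (and `k < L`) then `i + 1 ≠ k + 1` in `ℤ/L`. -/
theorem zmod_add_one_ne {i : ZMod L} {k : ℕ} (hk : k < L) (hi : k + 1 < i.val) :
    i + 1 ≠ ((k + 1 : ℕ) : ZMod L) := by
  intro e
  rw [Nat.cast_succ, add_left_inj] at e
  rw [e, ZMod.val_natCast, Nat.mod_eq_of_lt hk] at hi
  omega

variable [NeZero L]

/-- An element of `ℤ/L` is the cast of its representative. -/
theorem zmod_eq_natCast_of_val_eq {i : ZMod L} {k : ℕ} (h : i.val = k) : i = ((k : ℕ) : ZMod L) := by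
  rw [← h, ZMod.natCast_zmod_val]

/-- Peeling the face `k + 1` off the faces `> k`: `{i | k < val i} = {k+1} ∪ {i | k+1 < val i}`. -/
theorem filter_val_gt_eq_insert {k : ℕ} (hk : k + 1 < L) :
    (Finset.univ.filter fun i : ZMod L => k < i.val) =
      insert ((k + 1 : ℕ) : ZMod L) (Finset.univ.filter fun i : ZMod L => k + 1 < i.val) := by
  ext i
  simp only [Finset.mem_filter, Finset.mem_insert, Finset.mem_univ, true_and]
  constructor
  · intro h
    by_cases hi : i.val = k + 1
    · exact Or.inl (zmod_eq_natCast_of_val_eq hi)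
    · exact Or.inr (by omega)
  · rintro (h | h)
    · rw [h, ZMod.val_natCast, Nat.mod_eq_of_lt hk]; omega
    · omega

/-- The face `k + 1` is not among the faces `> k + 1`. -/
theorem natCast_notMem_filter_val_gt {k : ℕ} (hk : k + 1 < L) :
    ((k + 1 : ℕ) : ZMod L) ∉ (Finset.univ.filter fun i : ZMod L => k + 1 < i.val) := by
  rw [Finset.mem_filter, ZMod.val_natCast, Nat.mod_eq_of_lt hk]
  exact fun h => lt_irrefl _ h.2

/-- **One face merging along the row.**  Integrating the vertical link `w_{k+1}` merges the face
`χ_{m_0}(A·w_{k+1}·B⁻¹·w_0⁻¹)` (the faces `0, …, k` already merged) with the face `k + 1`: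
the result is `[m_0 = m_{k+1}]·(m_0+1)⁻¹·χ_{m_0}((A a_{k+1})·w_{k+2}·(B b_{k+1})⁻¹·w_0⁻¹)` times the
untouched faces `> k + 1`. -/
theorem integral_row_face_merge (a b : ZMod L → Matrix.specialUnitaryGroup (Fin 2) ℂ) (m : ZMod L → ℕ)
    {k : ℕ} (hkL : k + 1 < L) (A B : Matrix.specialUnitaryGroup (Fin 2) ℂ) :
    ∫ w, (U ℝ (m 0)).eval (su2a0 (A * w ((k + 1 : ℕ) : ZMod L) * B⁻¹ * (w 0)⁻¹)) *
          ∏ i ∈ Finset.univ.filter (fun i : ZMod L => k < i.val),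
            (U ℝ (m i)).eval (su2a0 (a i * w (i + 1) * (b i)⁻¹ * (w i)⁻¹))
        ∂(Measure.pi fun _ : ZMod L => haarProbability (Matrix.specialUnitaryGroup (Fin 2) ℂ)) =
      if m 0 = m ((k + 1 : ℕ) : ZMod L) then ((m 0 : ℝ) + 1)⁻¹ *
        ∫ w, (U ℝ (m 0)).eval (su2a0 (A * a ((k + 1 : ℕ) : ZMod L) * w ((k + 1 + 1 : ℕ) : ZMod L) *
              (B * b ((k + 1 : ℕ) : ZMod L))⁻¹ * (w 0)⁻¹)) *
            ∏ i ∈ Finset.univ.filter (fun i : ZMod L => k + 1 < i.val),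
              (U ℝ (m i)).eval (su2a0 (a i * w (i + 1) * (b i)⁻¹ * (w i)⁻¹))
          ∂(Measure.pi fun _ : ZMod L => haarProbability (Matrix.specialUnitaryGroup (Fin 2) ℂ))
      else 0 := by
  haveI : Fact (1 < L) := ⟨by omega⟩
  have hc0 : (0 : ZMod L) ≠ ((k + 1 : ℕ) : ZMod L) := by
    rw [← Nat.cast_zero]
    exact natCast_zmod_ne_of_lt (by omega) hkL (by omega)
  have hc1 : ((k + 1 : ℕ) : ZMod L) + 1 ≠ ((k + 1 : ℕ) : ZMod L) := by
    rw [ne_eq, add_eq_left]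
    exact one_ne_zero
  -- the merge lemma on the slice `w_{k+1}`
  have hmerge := integral_pi_su2_merge (ι := ZMod L) ((k + 1 : ℕ) : ZMod L) (fun _ => A)
    (fun w => B⁻¹ * (w 0)⁻¹)
    (fun w => a ((k + 1 : ℕ) : ZMod L) * w (((k + 1 : ℕ) : ZMod L) + 1) * (b ((k + 1 : ℕ) : ZMod L))⁻¹)
    (fun w => ∏ i ∈ Finset.univ.filter (fun i : ZMod L => k + 1 < i.val),
      (U ℝ (m i)).eval (su2a0 (a i * w (i + 1) * (b i)⁻¹ * (w i)⁻¹)))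
    (fun _ _ => rfl) (fun w g => by rw [update_of_ne hc0]) (fun w g => by rw [update_of_ne hc1])
    (fun w g => by
      refine Finset.prod_congr rfl fun i hi => ?_
      have hi' : k + 1 < i.val := (Finset.mem_filter.mp hi).2
      have hic : i ≠ ((k + 1 : ℕ) : ZMod L) := fun e => by
        rw [e, ZMod.val_natCast, Nat.mod_eq_of_lt hkL] at hi'
        exact lt_irrefl _ hi'
      rw [update_of_ne hic, update_of_ne (zmod_add_one_ne (by omega) hi')])
    continuous_const (by fun_prop) (by fun_prop)
    (continuous_finsetProd _ fun i _ => continuous_su2Character_comp (m i) (by fun_prop))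
    (m 0) (m ((k + 1 : ℕ) : ZMod L))
  beta_reduce at hmerge
  -- bring the integrand into merge form: split off the face `k + 1` and reassociate
  have hpt : ∀ w : ZMod L → Matrix.specialUnitaryGroup (Fin 2) ℂ,
      (U ℝ (m 0)).eval (su2a0 (A * w ((k + 1 : ℕ) : ZMod L) * B⁻¹ * (w 0)⁻¹)) *
          ∏ i ∈ Finset.univ.filter (fun i : ZMod L => k < i.val),
            (U ℝ (m i)).eval (su2a0 (a i * w (i + 1) * (b i)⁻¹ * (w i)⁻¹)) =
        (U ℝ (m 0)).eval (su2a0 (A * w ((k + 1 : ℕ) : ZMod L) * (B⁻¹ * (w 0)⁻¹))) *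
          (U ℝ (m ((k + 1 : ℕ) : ZMod L))).eval (su2a0 (a ((k + 1 : ℕ) : ZMod L) *
            w (((k + 1 : ℕ) : ZMod L) + 1) * (b ((k + 1 : ℕ) : ZMod L))⁻¹ * (w ((k + 1 : ℕ) : ZMod L))⁻¹)) *
          ∏ i ∈ Finset.univ.filter (fun i : ZMod L => k + 1 < i.val),
            (U ℝ (m i)).eval (su2a0 (a i * w (i + 1) * (b i)⁻¹ * (w i)⁻¹)) := by
    intro w
    rw [filter_val_gt_eq_insert hkL, Finset.prod_insert (natCast_notMem_filter_val_gt hkL)]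
    simp only [mul_assoc]
  rw [integral_congr_ae (Filter.Eventually.of_forall hpt), hmerge]
  by_cases hmc : m 0 = m ((k + 1 : ℕ) : ZMod L)
  · rw [if_pos hmc, if_pos hmc]
    congr 1
    refine integral_congr_ae (Filter.Eventually.of_forall fun w => ?_)
    beta_reduce
    have hcs : ((k + 1 : ℕ) : ZMod L) + 1 = ((k + 1 + 1 : ℕ) : ZMod L) := by push_cast; ring
    have hg : A * (a ((k + 1 : ℕ) : ZMod L) * w (((k + 1 : ℕ) : ZMod L) + 1) * (b ((k + 1 : ℕ) : ZMod L))⁻¹) *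
        (B⁻¹ * (w 0)⁻¹) =
        A * a ((k + 1 : ℕ) : ZMod L) * w ((k + 1 + 1 : ℕ) : ZMod L) * (B * b ((k + 1 : ℕ) : ZMod L))⁻¹ *
          (w 0)⁻¹ := by
      rw [hcs, mul_inv_rev]
      group
    rw [hg]
  · rw [if_neg hmc, if_neg hmc]

/-- **The row integral after `k` face mergings** (`k + 1 ≤ L`): the faces `0, …, k` of the row have
merged into the single face `χ_{m_0}(a_0⋯a_k · w_{k+1} · (b_0⋯b_k)⁻¹ · w_0⁻¹)/(m_0+1)^k`, provided
`m_0 = ⋯ = m_k`; otherwise the row integral vanishes. -/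
theorem integral_row_su2Character_step (a b : ZMod L → Matrix.specialUnitaryGroup (Fin 2) ℂ)
    (m : ZMod L → ℕ) (k : ℕ) (hk : k + 1 ≤ L) :
    ∫ w, ∏ i, (U ℝ (m i)).eval (su2a0 (a i * w (i + 1) * (b i)⁻¹ * (w i)⁻¹))
        ∂(Measure.pi fun _ : ZMod L => haarProbability (Matrix.specialUnitaryGroup (Fin 2) ℂ)) =
      if (∀ j < k + 1, m ((j : ℕ) : ZMod L) = m 0) then
        (((m 0 : ℝ) + 1) ^ k)⁻¹ *
          ∫ w, (U ℝ (m 0)).eval (su2a0 (((List.range (k + 1)).map fun j : ℕ => a j).prod *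
              w ((k + 1 : ℕ) : ZMod L) * (((List.range (k + 1)).map fun j : ℕ => b j).prod)⁻¹ * (w 0)⁻¹)) *
            ∏ i ∈ Finset.univ.filter (fun i : ZMod L => k < i.val),
              (U ℝ (m i)).eval (su2a0 (a i * w (i + 1) * (b i)⁻¹ * (w i)⁻¹))
          ∂(Measure.pi fun _ : ZMod L => haarProbability (Matrix.specialUnitaryGroup (Fin 2) ℂ))
      else 0 := by
  induction k with
  | zero =>
    -- no merging yet: split off the face `0`
    have hcond : ∀ j < 0 + 1, m ((j : ℕ) : ZMod L) = m 0 := by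
      intro j hj
      obtain rfl : j = 0 := by omega
      rw [Nat.cast_zero]
    rw [if_pos hcond, pow_zero, inv_one, one_mul]
    refine integral_congr_ae (Filter.Eventually.of_forall fun w => ?_)
    beta_reduce
    have hfilter : (Finset.univ.filter fun i : ZMod L => 0 < i.val) = Finset.univ.erase 0 := by
      ext i
      simp only [Finset.mem_filter, Finset.mem_univ, true_and, Finset.mem_erase, and_true,
        Nat.pos_iff_ne_zero, ne_eq, ZMod.val_eq_zero]
    rw [hfilter]
    conv_lhs => rw [← Finset.mul_prod_erase _ _ (Finset.mem_univ (0 : ZMod L))]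
    congr 1
    simp [List.range_succ]
  | succ k ih =>
    have hkL : k + 1 < L := by omega
    rw [ih (by omega)]
    by_cases hC : ∀ j < k + 1, m ((j : ℕ) : ZMod L) = m 0
    · rw [if_pos hC, integral_row_face_merge a b m hkL]
      have hrange : ∀ f : ℕ → Matrix.specialUnitaryGroup (Fin 2) ℂ,
          ((List.range (k + 1 + 1)).map f).prod = ((List.range (k + 1)).map f).prod * f (k + 1) := by
        intro f
        rw [List.range_succ, List.map_append, List.prod_append, List.map_singleton, List.prod_singleton]
      rw [hrange (fun j : ℕ => a j), hrange (fun j : ℕ => b j)]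
      by_cases hmc : m 0 = m ((k + 1 : ℕ) : ZMod L)
      · have hC' : ∀ j < k + 1 + 1, m ((j : ℕ) : ZMod L) = m 0 := by
          intro j hj
          by_cases hj' : j < k + 1
          · exact hC j hj'
          · obtain rfl : j = k + 1 := by omega
            exact hmc.symm
        rw [if_pos hmc, if_pos hC', ← mul_assoc, ← mul_inv, ← pow_succ]
      · have hC' : ¬ ∀ j < k + 1 + 1, m ((j : ℕ) : ZMod L) = m 0 := fun h =>
          hmc (h (k + 1) (by omega)).symm
        rw [if_neg hmc, if_neg hC', mul_zero]
    · have hC' : ¬ ∀ j < k + 1 + 1, m ((j : ℕ) : ZMod L) = m 0 := fun h =>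
        hC fun j hj => h j (by omega)
      rw [if_neg hC, if_neg hC']

/-- **THE ROW INTEGRAL.**  For `L ≥ 1`, horizontal links `a, b : ℤ/L → SU(2)` below and above a row of
the torus, representations `m : ℤ/L → ℕ` on its plaquettes and the vertical links `w : ℤ/L → SU(2)`
of the row integrated against product Haar measure:
`∫ ∏_i χ_{m_i}(a_i·w_{i+1}·b_i⁻¹·w_i⁻¹) dHaar^{⊗(ℤ/L)}(w)
   = [∀ i, m_i = m_0]·χ_{m_0}(a_0 a_1 ⋯ a_{L−1})·χ_{m_0}(b_0 b_1 ⋯ b_{L−1}) / (m_0+1)^L`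
(`L − 1` face mergings and one handle): the row contributes the characters of its two row holonomies,
in a representation constant along the row, with the weight `dim^{−L}`. -/
theorem integral_row_su2Character (a b : ZMod L → Matrix.specialUnitaryGroup (Fin 2) ℂ) (m : ZMod L → ℕ) :
    ∫ w, ∏ i, (U ℝ (m i)).eval (su2a0 (a i * w (i + 1) * (b i)⁻¹ * (w i)⁻¹))
        ∂(Measure.pi fun _ : ZMod L => haarProbability (Matrix.specialUnitaryGroup (Fin 2) ℂ)) =
      if (∀ i, m i = m 0) then
        (U ℝ (m 0)).eval (su2a0 ((List.range L).map fun j : ℕ => a j).prod) *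
          (U ℝ (m 0)).eval (su2a0 ((List.range L).map fun j : ℕ => b j).prod) / ((m 0 : ℝ) + 1) ^ L
      else 0 := by
  obtain ⟨L', rfl⟩ : ∃ L', L = L' + 1 := Nat.exists_eq_succ_of_ne_zero (NeZero.ne L)
  rw [integral_row_su2Character_step a b m L' le_rfl]
  have hcond : (∀ j < L' + 1, m ((j : ℕ) : ZMod (L' + 1)) = m 0) ↔ ∀ i, m i = m 0 := by
    constructor
    · intro h i
      rw [← ZMod.natCast_zmod_val i]
      exact h i.val (ZMod.val_lt i)
    · exact fun h j _ => h _
  by_cases hC : ∀ i, m i = m 0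
  · rw [if_pos (hcond.mpr hC), if_pos hC]
    have hempty : (Finset.univ.filter fun i : ZMod (L' + 1) => L' < i.val) = ∅ := by
      refine Finset.filter_eq_empty_iff.mpr fun i _ => ?_
      have := ZMod.val_lt i
      omega
    have hL0 : ((L' + 1 : ℕ) : ZMod (L' + 1)) = 0 := ZMod.natCast_self _
    simp_rw [hempty, Finset.prod_empty, hL0]
    have h := integral_pi_su2_handle (ι := ZMod (L' + 1)) 0
      (fun _ => ((List.range (L' + 1)).map fun j : ℕ => a j).prod)
      (fun _ => (((List.range (L' + 1)).map fun j : ℕ => b j).prod)⁻¹) (fun _ => (1 : ℝ))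
      (fun _ _ => rfl) (fun _ _ => rfl) (fun _ _ => rfl) continuous_const continuous_const
      continuous_const (m 0)
    beta_reduce at h
    rw [h, integral_const, probReal_univ, one_smul, su2a0_inv, pow_succ]
    have h0 : ((m 0 : ℝ) + 1) ≠ 0 := by positivity
    field_simp
  · rw [if_neg (fun h => hC (hcond.mp h)), if_neg hC]

end Row

end Summit.Ventures.LatticeQCDFlow.Scoring
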